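import Summits.RiemannHypothesis.RiemannHypothesis.Theorems.HandoffVerifiedGramKernel
import Literature.NumberTheory.LFunctions.WeilLineSupSamplingPrelim
import HarnessLib

/-!
# No near-null sampling certificate with a non-positive margin (handoff prove-1, ATTEMPT-19, THEOREM R′)

THEOREM R (`HandoffReachCeiling.reach_inequality`) bounds the reach of the zero-side transfer for
certificates with margin `c ≥ 0`.  This file disposes of the remaining case: for `c ≤ 0` the
near-null sampling hypothesis `NearNullSamplingK a φ T₀ h c θ p D k` of THEOREM V is FALSE as soon
as the split tariff is positive and the window carries one nonzero test (`a > 0`), for any split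
kernel whatsoever.  Proof: with `c ≤ 0` the hypothesis says `τ ‖g‖₂² ≤ 𝒱_φ(g)` for every window
test; modulating a fixed test `g₀` by `e^{iωx}` keeps support and `L²` norm and translates its
transform along the critical line (`Literature…weilMellin_mul_cexp_ofReal_mul_I_half`), so the
finitely many verified ordinates `|γ| ≤ T₀` see `‖ĝ₀(1/2 + i(γ+ω))‖² ≤ C_{g₀}²/(1+(γ+ω)²)²`, which
is `≤ C_{g₀}²/R²` once `ω = |T₀| + R`; `R` large contradicts `τ ‖g₀‖₂² > 0`.
No hypothesis on the zeros of `ζ`; nothing here bears on the truth of RH (paper: handoff/prove-1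
ATTEMPT-19 §3).
-/

set_option linter.dupNamespace false  -- the mandated namespace repeats `RiemannHypothesis`

open scoped Real
open Complex MeasureTheory Set Filter Literature.NumberTheory.LFunctions
  Literature.Analysis.SpecialFunctions

namespace Summit.RiemannHypothesis.RiemannHypothesis.Theorems

variable {φ : ℝ → ℂ} {a δ : ℝ}

/-- Modulation preserves the `L²` norm: `‖g e^{iω·}‖₂² = ‖g‖₂²`. -/
theorem weilNorm2Sq_mul_cexp_ofReal_mul_I (g : ℝ → ℂ) (ω : ℝ) :
    weilNorm2Sq (fun t ↦ g t * cexp ((ω * t : ℝ) * I)) = weilNorm2Sq g := by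
  unfold weilNorm2Sq
  congr 1 with t
  rw [norm_mul, Complex.norm_exp_ofReal_mul_I, mul_one]

/-- The verified Gram form of a MODULATED test `g e^{iωx}` with `ω = |T₀| + R`, `R ≥ 1`:
every verified ordinate is pushed beyond `R`, so `𝒱_φ(g e^{iω·}) ≤ (C_g²/R²) · Σ_{ρ ∈ weilZeroIndex T₀} m(ρ)`. -/
theorem verifiedGramK_modulated_le {g : ℝ → ℂ} (hg : IsWeilTest g) (hφ : IsSplitKernel φ δ)
    (T₀ : ℝ) {R : ℝ} (hR : 1 ≤ R) :
    verifiedGramK (fun t ↦ g t * cexp ((((|T₀| + R) * t : ℝ)) * I)) φ T₀ ≤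
      weilDecayConst g ^ 2 / R ^ 2 *
        ∑ᶠ ρ ∈ weilZeroIndex T₀, (riemannZetaZeroOrder ρ : ℝ) := by
  have hfin := weilZeroIndex_finite T₀
  set ω : ℝ := |T₀| + R with hω
  set C := weilDecayConst g with hC
  have hC0 : 0 ≤ C := weilDecayConst_nonneg g
  have hR0 : 0 < R := by linarith
  unfold verifiedGramK
  rw [finsum_mem_eq_finite_toFinset_sum _ hfin, finsum_mem_eq_finite_toFinset_sum _ hfin,
    Finset.mul_sum]
  refine Finset.sum_le_sum fun ρ hρ ↦ ?_
  rw [Set.Finite.mem_toFinset] at hρ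
  obtain ⟨-, -, -, him, hle⟩ := hρ
  have hm0 : (0 : ℝ) ≤ riemannZetaZeroOrder ρ := by
    exact_mod_cast riemannZetaZeroOrder_nonneg (fun h ↦ him (by rw [h]; simp))
  -- the shifted ordinate is at least `R`
  have hshift : R ≤ ρ.im + ω := by
    have h1 : -T₀ ≤ ρ.im := (abs_le.1 hle).1
    have h2 : T₀ ≤ |T₀| := le_abs_self T₀
    rw [hω]; linarith
  have hsq : R ^ 2 ≤ 1 + (ρ.im + ω) ^ 2 := by nlinarith
  have hdec : ‖weilMellin g (1 / 2 + ((ρ.im + ω : ℝ) : ℂ) * I)‖ ≤ C / (1 + (ρ.im + ω) ^ 2) := by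
    have := norm_weilMellin_le hg (s := 1 / 2 + ((ρ.im + ω : ℝ) : ℂ) * I) (by simp) (by norm_num)
    simpa [hC] using this
  have hpos : 0 < 1 + (ρ.im + ω) ^ 2 := by positivity
  have hG : lowLineDensityK (fun t ↦ g t * cexp (((ω * t : ℝ)) * I)) φ ρ.im ≤ C ^ 2 / R ^ 2 := by
    unfold lowLineDensityK
    rw [weilMellin_mul_cexp_ofReal_mul_I_half]
    have h0 : 0 ≤ ‖weilMellin g (1 / 2 + ((ρ.im + ω : ℝ) : ℂ) * I)‖ := norm_nonneg _
    have h1 : ‖weilMellin g (1 / 2 + ((ρ.im + ω : ℝ) : ℂ) * I)‖ ^ 2 ≤ (C / (1 + (ρ.im + ω) ^ 2)) ^ 2 :=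
      pow_le_pow_left₀ h0 hdec 2
    have h2 : lineSymbol φ ρ.im ≤ 1 := hφ.line_le_one _
    have h3 : 0 ≤ lineSymbol φ ρ.im := hφ.line_nonneg _
    have h4 : (C / (1 + (ρ.im + ω) ^ 2)) ^ 2 ≤ C ^ 2 / R ^ 2 := by
      rw [div_pow]
      have : C ^ 2 / (1 + (ρ.im + ω) ^ 2) ^ 2 ≤ C ^ 2 / (1 + (ρ.im + ω) ^ 2) := by
        apply div_le_div_of_nonneg_left (sq_nonneg _) hpos
        nlinarith
      refine this.trans ?_
      exact div_le_div_of_nonneg_left (sq_nonneg _) (by positivity) hsq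
    calc ‖weilMellin g (1 / 2 + ((ρ.im + ω : ℝ) : ℂ) * I)‖ ^ 2 * lineSymbol φ ρ.im
        ≤ (C / (1 + (ρ.im + ω) ^ 2)) ^ 2 * 1 := mul_le_mul h1 h2 h3 (sq_nonneg _)
      _ ≤ C ^ 2 / R ^ 2 := by rw [mul_one]; exact h4
  calc (riemannZetaZeroOrder ρ : ℝ) * lowLineDensityK (fun t ↦ g t * cexp (((ω * t : ℝ)) * I)) φ ρ.im
      ≤ (riemannZetaZeroOrder ρ : ℝ) * (C ^ 2 / R ^ 2) := mul_le_mul_of_nonneg_left hG hm0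
    _ = C ^ 2 / R ^ 2 * (riemannZetaZeroOrder ρ : ℝ) := by ring

/-- **THEOREM R′ (no certificate with non-positive margin).** For ANY split kernel `φ` and parameters
with `c ≤ 0` and positive split tariff, the near-null sampling hypothesis of THEOREM V fails as soon
as the window `[-a, a]` carries one Weil test of positive `L²` norm.  (Complements
`HandoffReachCeiling.reach_inequality`, which treats `c ≥ 0`.)  No hypothesis on the zeros of `ζ`. -/
theorem not_nearNullSamplingK_of_margin_nonpos (hφ : IsSplitKernel φ δ) {T₀ h c θ p D : ℝ}
    {k : ℕ} (hc : c ≤ 0) (hτ : 0 < splitTariff a T₀ h θ p D k) {g₀ : ℝ → ℂ}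
    (hg₀ : IsWeilTest g₀) (hsupp₀ : tsupport g₀ ⊆ Icc (-a) a) (hN₀ : 0 < weilNorm2Sq g₀) :
    ¬ NearNullSamplingK a φ T₀ h c θ p D k := by
  intro hNNS
  set C := weilDecayConst g₀ with hC
  set Mtot : ℝ := ∑ᶠ ρ ∈ weilZeroIndex T₀, (riemannZetaZeroOrder ρ : ℝ) with hM
  set τ := splitTariff a T₀ h θ p D k with hτdef
  have hMtot0 : 0 ≤ Mtot := by
    rw [hM]
    refine finsum_nonneg fun ρ ↦ finsum_nonneg fun hρ ↦ ?_
    have him : ρ.im ≠ 0 := hρ.2.2.2.1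
    exact_mod_cast riemannZetaZeroOrder_nonneg (fun h ↦ him (by rw [h]; simp))
  have hq0 : 0 ≤ C ^ 2 * Mtot / (τ * weilNorm2Sq g₀) := by positivity
  set R : ℝ := Real.sqrt (C ^ 2 * Mtot / (τ * weilNorm2Sq g₀)) + 1 with hR
  have hs0 : 0 ≤ Real.sqrt (C ^ 2 * Mtot / (τ * weilNorm2Sq g₀)) := Real.sqrt_nonneg _
  have hR1 : 1 ≤ R := by rw [hR]; linarith
  have hR2 : C ^ 2 * Mtot / (τ * weilNorm2Sq g₀) < R ^ 2 := by
    have hss := Real.sq_sqrt hq0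
    rw [hR]; nlinarith
  -- the modulated test
  set ω : ℝ := |T₀| + R with hω
  set g : ℝ → ℂ := fun t ↦ g₀ t * cexp (((ω * t : ℝ)) * I) with hg
  have hgT : IsWeilTest g := isWeilTest_mul_cexp_ofReal_mul_I hg₀ ω
  have hgS : tsupport g ⊆ Icc (-a) a := (tsupport_mul_cexp_subset g₀ ω).trans hsupp₀
  have hN : weilNorm2Sq g = weilNorm2Sq g₀ := weilNorm2Sq_mul_cexp_ofReal_mul_I g₀ ω
  have h1 := hNNS g hgT hgS
  rw [hN] at h1
  have hM0 : 0 ≤ highMassK g φ := highMassK_nonneg hφ g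
  have hcM : c * highMassK g φ ≤ 0 := mul_nonpos_of_nonpos_of_nonneg hc hM0
  have hV : verifiedGramK g φ T₀ ≤ C ^ 2 / R ^ 2 * Mtot := by
    have := verifiedGramK_modulated_le hg₀ hφ T₀ hR1
    rw [← hω] at this
    exact this
  -- `τ N₀ ≤ 𝒱 ≤ C² Mtot / R² < τ N₀`
  have hR0 : 0 < R := by linarith
  have hlt : C ^ 2 / R ^ 2 * Mtot < τ * weilNorm2Sq g₀ := by
    have hτN : 0 < τ * weilNorm2Sq g₀ := mul_pos hτ hN₀
    rw [div_lt_iff₀ hτN] at hR2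
    have hRR : 0 < R ^ 2 := by positivity
    rw [div_mul_eq_mul_div, div_lt_iff₀ hRR]
    linarith
  linarith

end Summit.RiemannHypothesis.RiemannHypothesis.Theorems
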